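import Summits.BirchSwinnertonDyer.BirchSwinnertonDyer.Theorems.EisensteinPrimesMazurMCOnCellBTwistbackOrderOneAnchorClassData
import HarnessLib

/-!
# Crux 3 `MazurMCOnCellB` (stmt-BirchSwinnertonDyer-19033), line `twistback` v11 → v12 — THE PARTNERED VERTEX AS A CONNECTED
# DATUM: Mazur's main conjecture at an X2b pair `(W, p)` whose class is joined by a zig-zag of certified two-steps to the CLASS
# of a vertex `W₀` carrying ONE good partner (admissible `K`, `ord_{s=1} L(E₀^{(d_K)}, s) = 1`, the upper half of `BSD(p)` at
# every minimal model of the twist); order-one anchors, sub-row vertices and the pair itself are partnered vertices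

LEAD bsd-line-x2-p1 (gen 15), cell `bsd-eis`, 2026-08-28. `--supports stmt-BirchSwinnertonDyer-19033 --as helper`.
HONEST FRAMING: THEOREMS ONLY (no `def`, no named fact introduced, no `sorry`); closes no registered stub; every theorem is
CONDITIONAL on the named facts it lists — `PublishedInputs` (item -19037), Mazur 1978 Cor. 4.1, Hsieh 2014 Thm. 1, LZZ 2018,
Disegni 2020 Thm. 4(1) / 2.4, Greenberg–Vatsal (3.11), Nakagawa–Horie–Taya (all PUBLISHED) and Keller–Yin 2024 Thm. D
(PREPRINT, flag KYD-gap) — i.e. inside the cone of the registered skeleton (stubs 1, 2, 3a); no summit statement, no Mazur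
main conjecture and no case of BSD is proved for any curve; 0 cells / labels / stubs / tiers move.

## Why

In twistback v4–v11 the registered open stub concludes the ∃-PARTNER AT the pair `(W, p)`; v7–v11 thread, as negated
hypotheses, the populations on which the crux is DERIVED: a Ш-unit class connected to `W`'s class (road (e)) and — v11 — a
non-split order-one anchor connected to it (road (b)). Both are instances of ONE road-independent datum: «a vertex `W₀`,
joined to the class of `W` by a zig-zag (up to isogeny at both ends), at which the ∃-PARTNER holds». `BSD_p` at such a `W₀` is
x2-p1-w6 g2's per-pair core p663790 (STEP L ⟸ Keller–Yin Thm. D), and it travels to `W` exactly as from a Ш-unit class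
(Cassels, x2-p1-w3 g14's zig-zag transport p671590, Cassels, exact converse). This file lands that door (§1) and records that
the order-one anchor (§2, via x2-p1-w3 g11's p661229), the closed sub-row at `p = 3` (§3, via p661280) and a partner AT the
pair (§3) are partnered vertices. The LEAD's v12 registers the road-independent form of the open stub:
«X2b, off the sub-row ⟹ connected Ш-unit class ∨ connected partnered vertex» — the SUPPLY statement itself.

## What

* §1 `bsdp_of_cellB_of_connectedPartner` / `mazurMainConjectureAt_of_cellB_of_connectedPartner` — the door.
* §2 `connectedPartner_of_connectedOrderOneAnchor` — the v11 anchor datum ⟹ the partnered-vertex datum (PUBLISHED facts: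
  `PublishedInputs`, Disegni Thm. 4(1), Disegni Thm. 2.4).
* §3 `connectedPartner_of_partnerAt` (fact-free) and `connectedPartner_of_subrow` (`p = 3`; PUBLISHED facts).

References: [KellerYin2024] Thm. D (= Thm. 5.1.3); [Disegni2020] §2.2 Thm. 2.4, §3.2 Thm. 4; [Wuthrich2014] Thm. 16;
[GreenbergVatsal2000] §3 Thm. (3.11); [NakagawaHorie1988] Thm. 1; [MilneADT2006] Thm. I.7.3; [Miller2011LMS] Def. 1.1; tree:
p663790, p671590, p674224, p661229, p661280, p675388.
-/

set_option autoImplicit false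

-- `Summit.BirchSwinnertonDyer.BirchSwinnertonDyer.…`: the summit and its single sub-problem share a name.
set_option linter.dupNamespace false

noncomputable section

open scoped Classical MatrixGroups ModularForm

open CongruenceSubgroup WeierstrassCurve NumberField IsDedekindDomain Field
  Literature.NumberTheory.EllipticCurves
  Literature.NumberTheory.GaloisRepresentations
  Literature.NumberTheory.EllipticCurves.ModularForms
  Literature.NumberTheory.QuadraticFields
  Literature.NumberTheory.EllipticCurves.Rank1Residual
  Literature.NumberTheory.EllipticCurves.Rank1Residual.Typed
  Literature.NumberTheory.EllipticCurves.Wuthrich2014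
  Literature.NumberTheory.EllipticCurves.Disegni2020
  Literature.NumberTheory.EllipticCurves.GreenbergVatsal2000
  Literature.NumberTheory.EllipticCurves.KellerYin2024
  Literature.NumberTheory.GaloisCohomology
  Summit.BirchSwinnertonDyer.Rank1Residual
  Summit.BirchSwinnertonDyer.Rank1Residual.X2
  Summit.BirchSwinnertonDyer.BirchSwinnertonDyer.Theses
  Summit.BirchSwinnertonDyer.BirchSwinnertonDyer.Theorems.EisensteinPrimesMazurMCOnCellBTwistbackTwoStepDefs

namespace Summit.BirchSwinnertonDyer.BirchSwinnertonDyer.Theorems.EisensteinPrimesMazurMCOnCellBTwistbackConnectedPartnerZigzag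

/-! ## §1. The door: `BSD_p` / Mazur's main conjecture at `(W, p)` from a CONNECTED PARTNERED VERTEX -/

/-- **`BSD(E, p)` at an X2b pair CONNECTED to a PARTNERED VERTEX.** Datum at the X2b pair `(W, p)`: globally minimal
`W₁ ∼ W`, a zig-zag `W₁ ⇝ U` (the twistback v10 relation: forward certified two-steps `TwoStepAt p`, or backward ones with an
X2b source), a globally minimal `W₀ ∼ U`, and ONE good partner at `W₀`: `K` imaginary quadratic, Heegner for `N_{W₀}` and `p`,
`d_K` odd `< −4`, `ord_{s=1} L(E₀^{(d_K)}, s) = 1`, and `Typed.MissingUpperBoundAt Wd p` at every globally minimal model `Wd` of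
`E₀^{(d_K)}` — VERBATIM the conclusion shape of the v4–v11 registered stubs, at `W₀`. Proof: X2b travels to `W₁`, `U`, `W₀`
(`X2.cellB_iff_of_isIsogenous` with Tate uniformisation DISCHARGED; x2-p1-w3 g15's `cellB_of_cellB_of_zigzag`), a minimal model of
the twist exists, p663790 `bsdp_of_cellB_of_upper_partnerAt` gives `BSDp W₀ p` (STEP L ⟸ Keller–Yin Thm. D + Poitou–Tate +
Hsieh + LZZ + Mazur Cor. 4.1), Cassels (`X2.bsdp_of_isIsogenous_of_bsdp`) moves it to `U`, p671590
`bsdp_of_cellB_of_zigzag_of_bsdp` to `W₁`, Cassels to `W`. Named facts BY NAME; CONDITIONAL; nothing about any curve is proved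
unconditionally; that every component HAS a partnered vertex is NOT claimed (it is the supply statement, open).
[claim: KellerYin2024, status: under-review] [cite: KellerYin2024, Thm. D = Thm. 5.1.3 (arXiv:2402.12781v2 L306–L309)]
[cite: MilneADT2006, Thm. I.7.3 (Cassels)] [cite: Mazur1978, Cor. 4.1] [cite: Miller2011LMS, Def. 1.1] -/
theorem bsdp_of_cellB_of_connectedPartner (hP : EisensteinPrimes.PublishedInputs)
    (hPT : ∀ (K : Type) [Field K] [NumberField K], poitouTate_selmerStructure_duality K)
    (hPT2 : ∀ (K : Type) [Field K] [NumberField K], poitouTate_sha_tateDual K)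
    (hH : hsieh2014_exists_anticyclotomicPAdicLFunction)
    (hF : LiuZhangZhang2018.thm151_thm153_modularCurve_heegnerVector) (hMaz : mazur_not_dvd_maninConstant_of_odd)
    (hD : KellerYin2024.thmD_imcMult_exists_isBDPLFunction_isTorsion_charIdeal_eq_OPEN)
    (W : WeierstrassCurve ℚ) [W.IsElliptic] [W.IsGloballyMinimal] (p : ℕ) [Fact p.Prime] (hc : X2.CellB W p)
    (hV : ∃ (W₁ : WeierstrassCurve ℚ) (_ : W₁.IsElliptic) (_ : W₁.IsGloballyMinimal)
      (U : WeierstrassCurve ℚ) (_ : U.IsElliptic) (_ : U.IsGloballyMinimal)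
      (W₀ : WeierstrassCurve ℚ) (_ : W₀.IsElliptic) (_ : W₀.IsGloballyMinimal),
      IsIsogenous W W₁ ∧
      Relation.ReflTransGen (fun A B : WeierstrassCurve ℚ ↦ TwoStepAt p A B ∨
        (TwoStepAt p B A ∧ ∃ (_ : B.IsElliptic) (_ : B.IsGloballyMinimal), X2.CellB B p)) W₁ U ∧
      IsIsogenous U W₀ ∧
      ∃ (K : Type) (_ : Field K) (_ : NumberField K), IsImaginaryQuadratic K ∧
        SatisfiesHeegnerHypothesis (W₀.conductorNorm ℤ) K ∧ SatisfiesHeegnerHypothesis p K ∧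
        Odd (NumberField.discr K) ∧ NumberField.discr K < -4 ∧
        (W₀.quadraticTwist (NumberField.discr K : ℚ)).analyticRank = 1 ∧
        ∀ (Wd : WeierstrassCurve ℚ) [Wd.IsElliptic] [Wd.IsGloballyMinimal],
          (∃ C : VariableChange ℚ, C • Wd = W₀.quadraticTwist (NumberField.discr K : ℚ)) →
          MissingUpperBoundAt Wd p) :
    BSDp W p := by
  have hCassels := hP.2.1
  have hnf := hP.2.2.2.2.2.1
  have hGZK := hP.2.2.2.2.2.2.2.2.2.2.1
  have hE : WeierstrassCurve.hasEntireLFunction_rat :=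
    WeierstrassCurve.hasEntireLFunction_rat_of_exists_isNewformOf hnf
  obtain ⟨W₁, _, _, U, _, _, W₀, _, _, hiso₁, hz, hisoU, K, _, _, hK, hHN, hHp, hodd, hlt, hr1, hU⟩ := hV
  have hc₁ : X2.CellB W₁ p :=
    (X2.cellB_iff_of_isIsogenous (p := p) TateCurve.Silverman1994_thmV53_tateUniformisation_holds
      TateCurve.Silverman1994_thmV53_corV54_tateUniformisation_holds hiso₁).mp hc
  obtain ⟨_, _, hcU⟩ :=
    EisensteinPrimesMazurMCOnCellBTwistbackZigzagClassData.cellB_of_cellB_of_zigzag hE hc₁ hz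
  have hc₀ : X2.CellB W₀ p :=
    (X2.cellB_iff_of_isIsogenous (p := p) TateCurve.Silverman1994_thmV53_tateUniformisation_holds
      TateCurve.Silverman1994_thmV53_corV54_tateUniformisation_holds hisoU).mp hcU
  have hd0 : (NumberField.discr K : ℚ) ≠ 0 := by exact_mod_cast NumberField.discr_ne_zero K
  obtain ⟨Wd, _, _, C, hC⟩ := exists_isGloballyMinimal_smul_eq_quadraticTwist W₀ hd0
  have hbsd₀ : BSDp W₀ p :=
    EisensteinPrimesMazurMCOnCellBTwistbackOnePartnerAt.bsdp_of_cellB_of_upper_partnerAt hP hPT hPT2 hH hF hMaz hD W₀ p hc₀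
      K hK hHN hHp hodd hlt hr1 Wd ⟨C, hC⟩ (hU Wd ⟨C, hC⟩)
  have hbsdU : BSDp U p :=
    X2.bsdp_of_isIsogenous_of_bsdp hCassels hGZK hE W₀ U hisoU.symm_of_charZero p (by rw [hc₀.1]; omega) hbsd₀
  have hbsd₁ : BSDp W₁ p :=
    EisensteinPrimesMazurMCOnCellBTwistbackDefectSwapZigzag.bsdp_of_cellB_of_zigzag_of_bsdp hP hMaz hH hF hD hc₁ hz hbsdU
  exact X2.bsdp_of_isIsogenous_of_bsdp hCassels hGZK hE W₁ W hiso₁.symm_of_charZero p (by rw [hc₁.1]; omega) hbsd₁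

/-- **Mazur's main conjecture at an X2b pair CONNECTED to a PARTNERED VERTEX** — `bsdp_of_cellB_of_connectedPartner` and the
exact converse at an odd multiplicative reducible rank-`0` pair (`X2.mazurMainConjectureAt_of_bsdp_of_red`; Wuthrich Thm. 16,
Stein–Wuthrich + canonical heights, Greenberg–Stevens, GZK, modularity from `PublishedInputs`). The theorem the LEAD's
twistback v12 feeds BY NAME on the branch of its open stub's second disjunct; `hV` is VERBATIM that disjunct. CONDITIONAL on
the cone {`PublishedInputs`, (2c), (2f), (2g), Keller–Yin Thm. D}; a main conjecture is proved for no curve.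
[claim: KellerYin2024, status: under-review] [cite: KellerYin2024, Thm. D = Thm. 5.1.3]
[cite: Wuthrich2014, Thm. 16 and §5 (p. 397)] [cite: GreenbergLNM1716, §4 (PDF pp. 112–113)] [cite: Miller2011LMS, Def. 1.1] -/
theorem mazurMainConjectureAt_of_cellB_of_connectedPartner (hP : EisensteinPrimes.PublishedInputs)
    (hPT : ∀ (K : Type) [Field K] [NumberField K], poitouTate_selmerStructure_duality K)
    (hPT2 : ∀ (K : Type) [Field K] [NumberField K], poitouTate_sha_tateDual K)
    (hH : hsieh2014_exists_anticyclotomicPAdicLFunction)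
    (hF : LiuZhangZhang2018.thm151_thm153_modularCurve_heegnerVector) (hMaz : mazur_not_dvd_maninConstant_of_odd)
    (hD : KellerYin2024.thmD_imcMult_exists_isBDPLFunction_isTorsion_charIdeal_eq_OPEN)
    (W : WeierstrassCurve ℚ) [W.IsElliptic] [W.IsGloballyMinimal] (p : ℕ) [Fact p.Prime] (hc : X2.CellB W p)
    (hV : ∃ (W₁ : WeierstrassCurve ℚ) (_ : W₁.IsElliptic) (_ : W₁.IsGloballyMinimal)
      (U : WeierstrassCurve ℚ) (_ : U.IsElliptic) (_ : U.IsGloballyMinimal)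
      (W₀ : WeierstrassCurve ℚ) (_ : W₀.IsElliptic) (_ : W₀.IsGloballyMinimal),
      IsIsogenous W W₁ ∧
      Relation.ReflTransGen (fun A B : WeierstrassCurve ℚ ↦ TwoStepAt p A B ∨
        (TwoStepAt p B A ∧ ∃ (_ : B.IsElliptic) (_ : B.IsGloballyMinimal), X2.CellB B p)) W₁ U ∧
      IsIsogenous U W₀ ∧
      ∃ (K : Type) (_ : Field K) (_ : NumberField K), IsImaginaryQuadratic K ∧
        SatisfiesHeegnerHypothesis (W₀.conductorNorm ℤ) K ∧ SatisfiesHeegnerHypothesis p K ∧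
        Odd (NumberField.discr K) ∧ NumberField.discr K < -4 ∧
        (W₀.quadraticTwist (NumberField.discr K : ℚ)).analyticRank = 1 ∧
        ∀ (Wd : WeierstrassCurve ℚ) [Wd.IsElliptic] [Wd.IsGloballyMinimal],
          (∃ C : VariableChange ℚ, C • Wd = W₀.quadraticTwist (NumberField.discr K : ℚ)) →
          MissingUpperBoundAt Wd p) :
    X2.MazurMainConjectureAt W p := by
  have hnf := hP.2.2.2.2.2.1
  have hGZK := hP.2.2.2.2.2.2.2.2.2.2.1
  have hWu := hP.2.2.2.2.2.2.2.2.2.2.2.2.2.2.1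
  have hJs := hP.2.2.2.2.2.2.2.2.2.2.2.2.2.2.2.1
  have hJn := hP.2.2.2.2.2.2.2.2.2.2.2.2.2.2.2.2.1
  have hHs := hP.2.2.2.2.2.2.2.2.2.2.2.2.2.2.2.2.2.1
  have hHn := hP.2.2.2.2.2.2.2.2.2.2.2.2.2.2.2.2.2.2.1
  have hGS := hP.2.2.2.2.2.2.2.2.2.2.2.2.2.2.2.2.2.2.2
  have hE : WeierstrassCurve.hasEntireLFunction_rat :=
    WeierstrassCurve.hasEntireLFunction_rat_of_exists_isNewformOf hnf
  exact X2.mazurMainConjectureAt_of_bsdp_of_red hWu hJs hJn hHs hHn hGZK hE W p (hGS W p) hc.2.1.1 hc.2.1.2.2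
    hc.2.1.2.1 hc.1 (bsdp_of_cellB_of_connectedPartner hP hPT hPT2 hH hF hMaz hD W p hc hV)

/-! ## §2. Order-one anchors are partnered vertices -/

/-- **The v11 connected ORDER-ONE ANCHOR datum ⟹ the connected PARTNERED-VERTEX datum** (PUBLISHED facts only): at the anchor
`W₀` (non-split, admissible `K₀` with p661229 §1's certificate `hordL`) x2-p1-w3 g11's `upperPartner_at_of_orderOne_partner_of_padicGZ`
gives a good partner at `W₀` (Perrin-Riou + Disegni Thm. 2.4 ⟹ `r_an = 1`; Disegni Thm. 4(1) under Greenberg–Vatsal ⟹ the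
upper half); `U := W₀`, `W₀ ∼ W₀`. Inputs BY NAME: `PublishedInputs`, Disegni Thm. 4(1), Disegni Thm. 2.4 (all PUBLISHED).
[cite: Disegni2020, §2.2 Thm. 2.4 and §3.2 Thm. 4] [cite: PerrinRiou1987, §1.4 Cor. 1.8] [cite: GreenbergVatsal2000, Thm. (1.3)] -/
theorem connectedPartner_of_connectedOrderOneAnchor (hP : EisensteinPrimes.PublishedInputs)
    (hDis : padicBSD_rankOne_nonsplitMult) (hDGZ : padicGrossZagier_nonsplitMult)
    {W : WeierstrassCurve ℚ} {p : ℕ} [Fact p.Prime]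
    (hA : ∃ (W₁ : WeierstrassCurve ℚ) (_ : W₁.IsElliptic) (_ : W₁.IsGloballyMinimal)
      (W₀ : WeierstrassCurve ℚ) (_ : W₀.IsElliptic) (_ : W₀.IsGloballyMinimal),
      IsIsogenous W W₁ ∧
      Relation.ReflTransGen (fun A B : WeierstrassCurve ℚ ↦ TwoStepAt p A B ∨
        (TwoStepAt p B A ∧ ∃ (_ : B.IsElliptic) (_ : B.IsGloballyMinimal), X2.CellB B p)) W₁ W₀ ∧
      ¬ W₀.HasSplitMultiplicativeReductionAtPrime p ∧
      ∃ (K : Type) (_ : Field K) (_ : NumberField K), IsImaginaryQuadratic K ∧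
        SatisfiesHeegnerHypothesis (W₀.conductorNorm ℤ) K ∧ SatisfiesHeegnerHypothesis p K ∧
        Odd (NumberField.discr K) ∧ NumberField.discr K < -4 ∧
        ∀ (Wd : WeierstrassCurve ℚ) [Wd.IsElliptic] [Wd.IsGloballyMinimal],
          (∃ C : VariableChange ℚ, C • Wd = W₀.quadraticTwist (NumberField.discr K : ℚ)) →
          ∀ {M : ℕ} [NeZero M] (f : CuspForm (Gamma0 M) 2), IsNewformOf Wd f →
          ∀ (ϖ : ℚ), (ϖ : ℝ) * Wd.realPeriodRat = plusPeriod f →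
          ∀ L : PowerSeries ℚ_[p], IsMultPAdicLFunctionOf f p (-1) L → L.order = ((1 : ℕ) : ℕ∞))
    (hc : X2.CellB W p) [W.IsElliptic] [W.IsGloballyMinimal] :
    ∃ (W₁ : WeierstrassCurve ℚ) (_ : W₁.IsElliptic) (_ : W₁.IsGloballyMinimal)
      (U : WeierstrassCurve ℚ) (_ : U.IsElliptic) (_ : U.IsGloballyMinimal)
      (W₀ : WeierstrassCurve ℚ) (_ : W₀.IsElliptic) (_ : W₀.IsGloballyMinimal),
      IsIsogenous W W₁ ∧
      Relation.ReflTransGen (fun A B : WeierstrassCurve ℚ ↦ TwoStepAt p A B ∨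
        (TwoStepAt p B A ∧ ∃ (_ : B.IsElliptic) (_ : B.IsGloballyMinimal), X2.CellB B p)) W₁ U ∧
      IsIsogenous U W₀ ∧
      ∃ (K : Type) (_ : Field K) (_ : NumberField K), IsImaginaryQuadratic K ∧
        SatisfiesHeegnerHypothesis (W₀.conductorNorm ℤ) K ∧ SatisfiesHeegnerHypothesis p K ∧
        Odd (NumberField.discr K) ∧ NumberField.discr K < -4 ∧
        (W₀.quadraticTwist (NumberField.discr K : ℚ)).analyticRank = 1 ∧
        ∀ (Wd : WeierstrassCurve ℚ) [Wd.IsElliptic] [Wd.IsGloballyMinimal],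
          (∃ C : VariableChange ℚ, C • Wd = W₀.quadraticTwist (NumberField.discr K : ℚ)) →
          MissingUpperBoundAt Wd p := by
  have hnf := hP.2.2.2.2.2.1
  have hE : WeierstrassCurve.hasEntireLFunction_rat :=
    WeierstrassCurve.hasEntireLFunction_rat_of_exists_isNewformOf hnf
  obtain ⟨W₁, _, _, W₀, _, _, hiso₁, hz, hns₀, K, _, _, hK, hHN, hHp, hodd, hlt, hordL⟩ := hA
  have hc₁ : X2.CellB W₁ p :=
    (X2.cellB_iff_of_isIsogenous (p := p) TateCurve.Silverman1994_thmV53_tateUniformisation_holds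
      TateCurve.Silverman1994_thmV53_corV54_tateUniformisation_holds hiso₁).mp hc
  obtain ⟨_, _, hc₀⟩ :=
    EisensteinPrimesMazurMCOnCellBTwistbackZigzagClassData.cellB_of_cellB_of_zigzag hE hc₁ hz
  obtain ⟨K', _, _, hK', hHN', hHp', hodd', hlt', hr1', hU'⟩ :=
    EisensteinPrimesMazurMCOnCellBTwistbackOrderOnePartnerPAdicGZ.upperPartner_at_of_orderOne_partner_of_padicGZ
      hP hDis hDGZ W₀ p hc₀ hns₀ K hK hHN hHp hodd hlt hordL
  exact ⟨W₁, inferInstance, inferInstance, W₀, inferInstance, inferInstance, W₀, inferInstance, inferInstance, hiso₁, hz,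
    isIsogenous_self W₀, K', inferInstance, inferInstance, hK', hHN', hHp', hodd', hlt', hr1',
    fun Wd _ _ hWd ↦ hU' Wd hWd⟩

/-! ## §3. The pair itself and the closed sub-row are partnered vertices -/

/-- **A partner AT the pair is a connected partnered vertex** (`W₁ := U := W₀ := W`, the empty zig-zag). Fact-free.
[folklore] -/
theorem connectedPartner_of_partnerAt {p : ℕ} [Fact p.Prime] (W : WeierstrassCurve ℚ) [W.IsElliptic]
    [W.IsGloballyMinimal]
    (h : ∃ (K : Type) (_ : Field K) (_ : NumberField K), IsImaginaryQuadratic K ∧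
      SatisfiesHeegnerHypothesis (W.conductorNorm ℤ) K ∧ SatisfiesHeegnerHypothesis p K ∧
      Odd (NumberField.discr K) ∧ NumberField.discr K < -4 ∧
      (W.quadraticTwist (NumberField.discr K : ℚ)).analyticRank = 1 ∧
      ∀ (Wd : WeierstrassCurve ℚ) [Wd.IsElliptic] [Wd.IsGloballyMinimal],
        (∃ C : VariableChange ℚ, C • Wd = W.quadraticTwist (NumberField.discr K : ℚ)) →
        MissingUpperBoundAt Wd p) :
    ∃ (W₁ : WeierstrassCurve ℚ) (_ : W₁.IsElliptic) (_ : W₁.IsGloballyMinimal)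
      (U : WeierstrassCurve ℚ) (_ : U.IsElliptic) (_ : U.IsGloballyMinimal)
      (W₀ : WeierstrassCurve ℚ) (_ : W₀.IsElliptic) (_ : W₀.IsGloballyMinimal),
      IsIsogenous W W₁ ∧
      Relation.ReflTransGen (fun A B : WeierstrassCurve ℚ ↦ TwoStepAt p A B ∨
        (TwoStepAt p B A ∧ ∃ (_ : B.IsElliptic) (_ : B.IsGloballyMinimal), X2.CellB B p)) W₁ U ∧
      IsIsogenous U W₀ ∧
      ∃ (K : Type) (_ : Field K) (_ : NumberField K), IsImaginaryQuadratic K ∧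
        SatisfiesHeegnerHypothesis (W₀.conductorNorm ℤ) K ∧ SatisfiesHeegnerHypothesis p K ∧
        Odd (NumberField.discr K) ∧ NumberField.discr K < -4 ∧
        (W₀.quadraticTwist (NumberField.discr K : ℚ)).analyticRank = 1 ∧
        ∀ (Wd : WeierstrassCurve ℚ) [Wd.IsElliptic] [Wd.IsGloballyMinimal],
          (∃ C : VariableChange ℚ, C • Wd = W₀.quadraticTwist (NumberField.discr K : ℚ)) →
          MissingUpperBoundAt Wd p :=
  ⟨W, inferInstance, inferInstance, W, inferInstance, inferInstance, W, inferInstance, inferInstance, isIsogenous_self W,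
    Relation.ReflTransGen.refl, isIsogenous_self W, h⟩

/-- **The closed sub-row is made of partnered vertices** (`p = 3`, `3` non-split, a rational `3`-line datum of local balance
one): x2-p1-w3 g11's sub-row theorem p661280 `upperPartner_at_three_of_balanceOne_of_padicGZ` gives a partner AT the pair from
PUBLISHED facts (`PublishedInputs`, Disegni Thm. 4(1), Greenberg–Vatsal (3.11), Disegni Thm. 2.4, Nakagawa–Horie–Taya), and §3
`connectedPartner_of_partnerAt` concludes. [cite: GreenbergVatsal2000, §3 Thm. (3.11)] [cite: NakagawaHorie1988, Thm. 1]
[cite: Disegni2020, §2.2 Thm. 2.4 and §3.2 Thm. 4] -/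
theorem connectedPartner_of_subrow (hP : EisensteinPrimes.PublishedInputs)
    (hDis : padicBSD_rankOne_nonsplitMult) (h311 : thm311_hasUnitContent_iff_and_order_eq_of_lineRamifiedEven)
    (hDGZ : padicGrossZagier_nonsplitMult)
    (hNHT : Literature.NumberTheory.QuadraticFields.nakagawaHorie_taya_exists_imaginary_h3_eq_one)
    (W : WeierstrassCurve ℚ) [W.IsElliptic] [W.IsGloballyMinimal] [Fact (Nat.Prime 3)] (hc : X2.CellB W 3)
    (hns : ¬ W.HasSplitMultiplicativeReductionAtPrime 3)
    (hbal : ∃ (Φ₀ : AddSubgroup (geomTorsion W (3 : ℤ))) (m : ℕ) (_ : NeZero m) (φ : DirichletCharacter (ZMod 3) m)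
        (d : ℕ) (_ : NeZero d) (ψ : DirichletCharacter (ZMod 3) d) (S₀ : Finset (HeightOneSpectrum (𝓞 ℚ))),
      IsRationalLine W 3 Φ₀ ∧ φ.IsPrimitive ∧ ψ.IsPrimitive ∧
      (∀ (σ : absoluteGaloisGroup ℚ), ∀ P ∈ Φ₀,
        σ • P = (φ ((modNCyclotomicCharacter ℚ m σ : (ZMod m)ˣ) : ZMod m)).val • P) ∧
      (∀ (σ : absoluteGaloisGroup ℚ) (P : geomTorsion W (3 : ℤ)),
        σ • P - (ψ ((modNCyclotomicCharacter ℚ d σ : (ZMod d)ˣ) : ZMod d)).val • P ∈ Φ₀) ∧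
      (∀ v ∈ S₀, ((3 : ℕ) : 𝓞 ℚ) ∉ v.asIdeal) ∧
      (∀ v : HeightOneSpectrum (𝓞 ℚ), v ∉ S₀ → ((3 : ℕ) : 𝓞 ℚ) ∉ v.asIdeal → W.HasGoodReductionAt v) ∧
      1 + ∑ v ∈ S₀, delta W 3 v =
        ∑ v ∈ S₀, ((if φ (Rat.HeightOneSpectrum.natGenerator v : ZMod m) =
              (Rat.HeightOneSpectrum.natGenerator v : ZMod 3)
            then sFactor 3 (Rat.HeightOneSpectrum.natGenerator v) else 0) +
          (if ψ (Rat.HeightOneSpectrum.natGenerator v : ZMod d) =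
              (Rat.HeightOneSpectrum.natGenerator v : ZMod 3)
            then sFactor 3 (Rat.HeightOneSpectrum.natGenerator v) else 0))) :
    ∃ (W₁ : WeierstrassCurve ℚ) (_ : W₁.IsElliptic) (_ : W₁.IsGloballyMinimal)
      (U : WeierstrassCurve ℚ) (_ : U.IsElliptic) (_ : U.IsGloballyMinimal)
      (W₀ : WeierstrassCurve ℚ) (_ : W₀.IsElliptic) (_ : W₀.IsGloballyMinimal),
      IsIsogenous W W₁ ∧
      Relation.ReflTransGen (fun A B : WeierstrassCurve ℚ ↦ TwoStepAt 3 A B ∨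
        (TwoStepAt 3 B A ∧ ∃ (_ : B.IsElliptic) (_ : B.IsGloballyMinimal), X2.CellB B 3)) W₁ U ∧
      IsIsogenous U W₀ ∧
      ∃ (K : Type) (_ : Field K) (_ : NumberField K), IsImaginaryQuadratic K ∧
        SatisfiesHeegnerHypothesis (W₀.conductorNorm ℤ) K ∧ SatisfiesHeegnerHypothesis 3 K ∧
        Odd (NumberField.discr K) ∧ NumberField.discr K < -4 ∧
        (W₀.quadraticTwist (NumberField.discr K : ℚ)).analyticRank = 1 ∧
        ∀ (Wd : WeierstrassCurve ℚ) [Wd.IsElliptic] [Wd.IsGloballyMinimal],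
          (∃ C : VariableChange ℚ, C • Wd = W₀.quadraticTwist (NumberField.discr K : ℚ)) →
          MissingUpperBoundAt Wd 3 :=
  connectedPartner_of_partnerAt W
    (EisensteinPrimesMazurMCOnCellBTwistbackSubrowPartnerAnyLinePAdicGZ.upperPartner_at_three_of_balanceOne_of_padicGZ
      hP hDis h311 hDGZ hNHT W hc hns hbal)

end Summit.BirchSwinnertonDyer.BirchSwinnertonDyer.Theorems.EisensteinPrimesMazurMCOnCellBTwistbackConnectedPartnerZigzag

end
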